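import Mathlib
import Literature.NumberTheory.Transcendental.GammaMonomialsProofs
import Summits.KontsevichZagierPeriods.KontsevichZagierPeriods.Theorems.SoloBlindDasClass
import Summits.KontsevichZagierPeriods.KontsevichZagierPeriods.Theorems.SoloBlindDasClass1155
import Summits.KontsevichZagierPeriods.KontsevichZagierPeriods.Theorems.SoloBlindH2Level420
import Summits.KontsevichZagierPeriods.KontsevichZagierPeriods.Theorems.SoloBlindLinkedLift55

/-!
# SoloBlind — every named torsion Γ-class of the programme is a TRUE identity (kernel, via Deligne 7.18 (a))

Sequel of `SoloBlindGammaValues` (classes `a₃₅`, `a₃₃`, `α₅₂`, `α₄₄`).  The solo-blind programme on the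
Kontsevich–Zagier conjecture (`paper/CERTIFICATE.md` §3f, `paper/hafnian-theorem.md` §§10–12, THEOREM Z⁺⁺)
names the following torsion classes of the Koblitz–Ogus lattices `U_M`:

* the Anderson/Kubert 2-classes `α_{4p}` (`SoloBlindDasClass.dasRep p`, level `4p`, `p` an odd prime
  `< 50`): `α₁₂, α₂₀, α₂₈` DIE (are generated by reflection, Gauss multiplication and two-term CM
  coincidences at some level), `α₄₄, α₅₂, …, α₁₈₈` are IMMORTAL;
* the Anderson–Das odd classes `a₅₅ = a_{5,11}` (`SoloBlindLinkedLift55.v55at110`, pulled back from level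
  `110`), `a_{2,3,5,7}` of level `420` (`SoloBlindH2Level420.aI`) and `a_{3,5,7,11}` of level `1155`
  (`SoloBlindDasClass1155.w1155`, 229 factors) — all immortal.

The companion files certify NON-derivability inside the one-level Fermat/Beta sub-calculus.  This file
certifies, for every one of them, the TRUTH of the identity "`(2πi)^{-c}` · Γ-monomial `∈ ℚ̄`" in the kernel,
by the tree's sorry-free `Literature.NumberTheory.Transcendental.deligne_gammaMonomial_algebraic_holds`
(Deligne, LNM 900, Thm. 7.18 (a), first clause; elementary road: Koblitz–Ogus) and finite `decide` checks:

* `coeffOf` — the exponent function of a list-encoded Γ-monomial; `sum_coeffOf_mul_eq_listKo` /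
  `isHodgeType_of_listKo` — the bridge "integer Koblitz–Ogus identities `listKo d u e = c·d` at the units
  `u < d` ⇒ `IsHodgeTypeGammaMonomial d (coeffOf e) c`" in LIST form (the Koblitz–Ogus sums are computed by
  ONE pass over the monomial, so that level `1155` with `480` units is a cheap `decide`; the Finset form is
  `SoloBlind.GammaValues.isHodgeType_of_koSum`, not imported here);
* `anderson_hodgeType_all`, `anderson_two_class_algebraic` — for EVERY odd prime `p < 50`:
  `(2πi)^{⌊(p-1)/4⌋} · Γ(α_{4p}) · Γ(1/2)^{[p ≡ 3 (4)]} ∈ ℚ̄` (the Koblitz–Ogus constant of `dasRep p` is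
  `-(p-1)/4`; for `p ≡ 3 (mod 4)` it is half-integral and the factor `Γ(2p/4p) = √π` makes it integral,
  as for `α₄₄` in `SoloBlindGammaValues`);
* `gamma55_algebraic`, `gamma420_algebraic`, `gamma1155_algebraic` — the three odd immortal classes are
  algebraic Γ-ratios outright (`c = 0`, no power of `π`).

So both halves of THEOREM Z⁺⁺'s dichotomy — "true" and "not derivable in D at the certified levels" — are
kernel facts for every class the programme names; "not derivable in D at ANY level" stays paper-level
(THEOREM Z⁺⁺, input L′).  No new axioms.
-/

namespace Summit.KontsevichZagierPeriods.KontsevichZagierPeriods.Theorems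
namespace SoloBlind
namespace GammaValuesAll

open Literature.NumberTheory.Transcendental

/-- A Γ-monomial of level `N` as a list of (index, exponent) pairs (the encoding of all `SoloBlind*` files;
same as `SoloBlind.GammaValues.GammaMonomial`, which this file does not import). -/
abbrev GammaMonomial := List (ℕ × ℤ)

/-- The exponent function `i ↦ n_i` of a Γ-monomial (repeated indices add up); same as
`SoloBlind.GammaValues.coeffOf`. -/
def coeffOf (e : GammaMonomial) (i : ℕ) : ℤ :=
  (e.map fun kc => if kc.1 = i then kc.2 else 0).sum

/-- Koblitz–Ogus sum of a Γ-monomial at the unit `u` of level `d`, scaled by `d`, in ONE pass over the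
list: `Σ_{(k,m) ∈ e} m · (u k mod d)`. -/
def listKo (d u : ℕ) (e : GammaMonomial) : ℤ :=
  (e.map fun kc => kc.2 * (((u * kc.1) % d : ℕ) : ℤ)).sum

/-- The Finset form used by `GammaValues.isHodgeType_of_koSum` equals the list form, provided every index
of the monomial lies in `[1, d)`. [this work] -/
theorem sum_coeffOf_mul_eq (d : ℕ) (w : ℕ → ℤ) :
    ∀ e : GammaMonomial, (∀ kc ∈ e, kc.1 ∈ Finset.Ico 1 d) →
      ∑ i ∈ Finset.Ico 1 d, coeffOf e i * w i = (e.map fun kc => kc.2 * w kc.1).sum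
  | [], _ => by simp [coeffOf]
  | kc :: e, h => by
      have hkc : kc.1 ∈ Finset.Ico 1 d := h kc (by simp)
      have he : ∀ kc' ∈ e, kc'.1 ∈ Finset.Ico 1 d := fun kc' hk => h kc' (by simp [hk])
      have hsplit : ∀ i, coeffOf (kc :: e) i = (if kc.1 = i then kc.2 else 0) + coeffOf e i := by
        intro i; simp [coeffOf]
      simp_rw [hsplit, add_mul, Finset.sum_add_distrib, sum_coeffOf_mul_eq d w e he]
      have : ∑ i ∈ Finset.Ico 1 d, (if kc.1 = i then kc.2 else 0) * w i = kc.2 * w kc.1 := by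
        have h1 : ∀ i ∈ Finset.Ico 1 d,
            (if kc.1 = i then kc.2 else 0) * w i = if kc.1 = i then kc.2 * w i else 0 := by
          intro i _; split <;> simp
        rw [Finset.sum_congr rfl h1, Finset.sum_ite_eq]
        simp [hkc]
      rw [this]
      simp

/-- `listKo` is the Koblitz–Ogus sum of `coeffOf e`. [this work] -/
theorem sum_coeffOf_mul_eq_listKo (d u : ℕ) (e : GammaMonomial) (h : ∀ kc ∈ e, kc.1 ∈ Finset.Ico 1 d) :
    ∑ i ∈ Finset.Ico 1 d, coeffOf e i * (((u * i) % d : ℕ) : ℤ) = listKo d u e :=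
  sum_coeffOf_mul_eq d (fun i => (((u * i) % d : ℕ) : ℤ)) e h

/-- **Bridge, list form.** The Hodge-type condition for `coeffOf e` with constant `c` follows from the
support condition and the `φ(d)` integer identities `listKo d u e = c·d`. [this work] -/
theorem isHodgeType_of_listKo {d : ℕ} (hd : 0 < d) (e : GammaMonomial) (c : ℤ)
    (hsupp : ∀ kc ∈ e, kc.1 ∈ Finset.Ico 1 d)
    (hko : ∀ u < d, Nat.Coprime u d → listKo d u e = c * d) :
    IsHodgeTypeGammaMonomial d (coeffOf e) c := by
  -- Finset form of the hypothesis (this is the hypothesis of `SoloBlind.GammaValues.isHodgeType_of_koSum`,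
  -- whose argument is repeated below in place rather than imported).
  have h : ∀ u < d, Nat.Coprime u d →
      ∑ i ∈ Finset.Ico 1 d, coeffOf e i * (((u * i) % d : ℕ) : ℤ) = c * d := fun u hu hcop => by
    rw [sum_coeffOf_mul_eq_listKo d u e hsupp]; exact hko u hu hcop
  intro u hu
  have hd' : (d : ℚ) ≠ 0 := by exact_mod_cast hd.ne'
  have hcop : Nat.Coprime (u % d) d := by
    have : Nat.gcd (u % d) d = Nat.gcd d u := (Nat.gcd_rec d u).symm
    rw [Nat.Coprime, this]
    exact Nat.Coprime.symm hu
  have key := h (u % d) (Nat.mod_lt u hd) hcop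
  have hfr : ∀ i ∈ Finset.Ico 1 d,
      (coeffOf e i : ℚ) * Int.fract ((u : ℚ) * i / d)
        = ((coeffOf e i * (((u % d * i) % d : ℕ) : ℤ) : ℤ) : ℚ) / (d : ℚ) := by
    intro i _
    have hq : ((u : ℚ) * i / d) = ((u * i : ℕ) : ℚ) / d := by push_cast; ring
    have hmod : u * i % d = u % d * i % d := by
      conv_rhs => rw [Nat.mul_mod, Nat.mod_mod]
      exact Nat.mul_mod u i d
    rw [hq, Int.fract_div_natCast_eq_div_natCast_mod, hmod, Int.cast_mul, Int.cast_natCast]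
    ring
  rw [Finset.sum_congr rfl hfr, ← Finset.sum_div, ← Int.cast_sum, key, Int.cast_mul, Int.cast_natCast]
  field_simp

/-! ### The Anderson / Kubert 2-classes `α_{4p}`, all odd primes `p < 50` -/

/-- Hodge-type representative of `α_{4p}`: `dasRep p` itself for `p ≡ 1 (mod 4)`, and `dasRep p + e_{2p}`
(extra factor `Γ(1/2) = √π`) for `p ≡ 3 (mod 4)`. -/
def rep (p : ℕ) : GammaMonomial :=
  if p % 4 = 1 then DasClass.dasRep p else DasClass.dasRep p ++ [(2 * p, 1)]

/-- Its Koblitz–Ogus constant `c = -⌊(p-1)/4⌋`. -/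
def cOf (p : ℕ) : ℤ := -(((p - 1) / 4 : ℕ) : ℤ)

/-- The finite check, all fourteen odd primes below `50` at once: level data, support in `[1, 4p)`, and
the Koblitz–Ogus sums `= c·4p` at every unit. -/
theorem anderson_hodgeType_all : ∀ p ∈ DasClass.smallPrimes,
    1 < 4 * p ∧ (∀ kc ∈ rep p, kc.1 ∈ Finset.Ico 1 (4 * p)) ∧
      (∀ u < 4 * p, Nat.Coprime u (4 * p) → listKo (4 * p) u (rep p) = cOf p * ((4 * p : ℕ) : ℤ)) := by
  decide +kernel

/-- **Every Anderson 2-class below level 200 is a true identity**: for each odd prime `p < 50`,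
`(2πi)^{⌊(p-1)/4⌋} · ∏_{0<k<4p} Γ(k/4p)^{(rep p)_k} ∈ ℚ̄`.  This covers the dying classes `α₁₂, α₂₀, α₂₈`
and the immortal ones `α₄₄, α₅₂, α₆₈, α₇₆, α₉₂, α₁₁₆, α₁₂₄, α₁₄₈, α₁₆₄, α₁₇₂, α₁₈₈`.
[this work; Deligne 1982 Thm. 7.18 (a)] -/
theorem anderson_two_class_algebraic :
    ∀ p ∈ DasClass.smallPrimes, IsAlgebraic ℚ (gammaTilde (4 * p) (coeffOf (rep p)) (cOf p)) := by
  intro p hp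
  obtain ⟨h1, hsupp, hko⟩ := anderson_hodgeType_all p hp
  exact deligne_gammaMonomial_algebraic_holds (4 * p) (coeffOf (rep p)) (cOf p) h1
    (isHodgeType_of_listKo (by omega) _ _ hsupp hko)

/-- The membership list, for the record: `smallPrimes = [3, 5, …, 47]`. -/
example : DasClass.smallPrimes = [3, 5, 7, 11, 13, 17, 19, 23, 29, 31, 37, 41, 43, 47] := rfl

/-- Instance `p = 3`: the dying class `α₁₂` — `∏ Γ(k/12)^{(dasRep 3 + e₆)_k} ∈ ℚ̄`. -/
theorem gamma12_algebraic : IsAlgebraic ℚ (gammaTilde 12 (coeffOf (rep 3)) 0) :=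
  anderson_two_class_algebraic 3 (by decide)

/-- Instance `p = 5`: the dying class `α₂₀` — `(2πi) · ∏ Γ(k/20)^{(dasRep 5)_k} ∈ ℚ̄`. -/
theorem gamma20_algebraic : IsAlgebraic ℚ (gammaTilde 20 (coeffOf (rep 5)) (-1)) :=
  anderson_two_class_algebraic 5 (by decide)

/-- Instance `p = 7`: the dying class `α₂₈` — `(2πi) · ∏ Γ(k/28)^{(dasRep 7 + e₁₄)_k} ∈ ℚ̄`. -/
theorem gamma28_algebraic : IsAlgebraic ℚ (gammaTilde 28 (coeffOf (rep 7)) (-1)) :=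
  anderson_two_class_algebraic 7 (by decide)

/-! ### The odd immortal classes `a₅₅`, `a_{2,3,5,7}` (level 420), `a_{3,5,7,11}` (level 1155) -/

/-- Das's class `a_{5,11}` at its own level `55` (indices of `LinkedLift55.v55at110` halved). -/
def v55 : GammaMonomial := LinkedLift55.v55at110.map fun kc => (kc.1 / 2, kc.2)

example : v55 = [(3, 1), (4, 1), (6, -1), (7, -1), (10, -1), (13, 1), (14, 1), (17, -1), (20, -1),
    (21, -1), (23, 1), (24, 1)] := by decide

/-- Support in `[1, 55)` and Koblitz–Ogus sums `= 0` of `v55` at every unit of level `55`. -/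
theorem ko55 : (∀ kc ∈ v55, kc.1 ∈ Finset.Ico 1 55) ∧
    (∀ u < 55, Nat.Coprime u 55 → listKo 55 u v55 = 0 * 55) := by
  decide +kernel

/-- Support in `[1, 420)` and Koblitz–Ogus sums `= 0` of `a_{2,3,5,7}` at every unit of level `420`. -/
theorem ko420 : (∀ kc ∈ H2Level420.aI, kc.1 ∈ Finset.Ico 1 420) ∧
    (∀ u < 420, Nat.Coprime u 420 → listKo 420 u H2Level420.aI = 0 * 420) := by
  decide +kernel

/-- Support in `[1, 1155)` and Koblitz–Ogus sums `= 0` of `a_{3,5,7,11}` at all `480` units of level `1155`. -/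
theorem ko1155 : (∀ kc ∈ DasClass1155.w1155, kc.1 ∈ Finset.Ico 1 1155) ∧
    (∀ u < 1155, Nat.Coprime u 1155 → listKo 1155 u DasClass1155.w1155 = 0 * 1155) := by
  decide +kernel

/-- **`a₅₅` is a true identity**:
`Γ(3/55)Γ(4/55)Γ(13/55)Γ(14/55)Γ(23/55)Γ(24/55) / (Γ(6/55)Γ(7/55)Γ(10/55)Γ(17/55)Γ(20/55)Γ(21/55)) ∈ ℚ̄`.
[this work; Deligne 1982 Thm. 7.18 (a)] -/
theorem gamma55_algebraic :
    IsAlgebraic ℚ (∏ i ∈ Finset.Ico (1 : ℕ) 55, ((Real.Gamma ((i : ℝ) / 55) : ℂ)) ^ (coeffOf v55 i)) := by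
  simpa [gammaTilde] using deligne_gammaMonomial_algebraic_holds 55 (coeffOf v55) 0 (by norm_num)
    (isHodgeType_of_listKo (by norm_num) _ _ ko55.1 ko55.2)

/-- **`a_{2,3,5,7}` (level 420) is a true identity**: `∏_{0<k<420} Γ(k/420)^{(aI)_k} ∈ ℚ̄` for the
64-factor canonical representative `H2Level420.aI`. [this work; Deligne 1982 Thm. 7.18 (a)] -/
theorem gamma420_algebraic :
    IsAlgebraic ℚ (∏ i ∈ Finset.Ico (1 : ℕ) 420,
      ((Real.Gamma ((i : ℝ) / 420) : ℂ)) ^ (coeffOf H2Level420.aI i)) := by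
  simpa [gammaTilde] using deligne_gammaMonomial_algebraic_holds 420 (coeffOf H2Level420.aI) 0
    (by norm_num) (isHodgeType_of_listKo (by norm_num) _ _ ko420.1 ko420.2)

/-- **`a_{3,5,7,11}` (level 1155) is a true identity**: `∏_{0<k<1155} Γ(k/1155)^{(w1155)_k} ∈ ℚ̄` for
Das's 229-factor representative `DasClass1155.w1155`. [this work; Deligne 1982 Thm. 7.18 (a)] -/
theorem gamma1155_algebraic :
    IsAlgebraic ℚ (∏ i ∈ Finset.Ico (1 : ℕ) 1155,
      ((Real.Gamma ((i : ℝ) / 1155) : ℂ)) ^ (coeffOf DasClass1155.w1155 i)) := by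
  simpa [gammaTilde] using deligne_gammaMonomial_algebraic_holds 1155 (coeffOf DasClass1155.w1155) 0
    (by norm_num) (isHodgeType_of_listKo (by norm_num) _ _ ko1155.1 ko1155.2)

end GammaValuesAll
end SoloBlind
end Summit.KontsevichZagierPeriods.KontsevichZagierPeriods.Theorems
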